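/-
Copyright (c) 2026. All rights reserved.
Released under Apache 2.0 license as described in the file LICENSE.
Authors: abc-iut cell — seat abc-iut-w4-d104 (gen 3): row «COR29-GLOBALISE» (L4-lead RULING #7e), generic
chart-package lemmas, rows (a), for [AbsTopIII] Cor 2.9 over an abstract space.
-/
import Literature.AnabelianGeometry.AbsoluteAnabelian.ArchimedeanReconstructionCor29ModelProofs
import HarnessLib

/-!
# [AbsTopIII] Cor 2.9 (a) along a CHART PACKAGE of an abstract space: the transported local additive
# structure, the limits `lim n · f((1/n)·ₓ v⃗)` and the functional `ι_{U_X,x}` — values in a field `k_v ≅ ℂ`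

S. Mochizuki, *Topics in absolute anabelian geometry III* (bib key `MochizukiAbsTopIII2015`), Cor 2.9 (a),
kurims pp.64–65.  PROOF-ONLY file (no definitions).  The sub-DAG statements of abc-iut-w5-d225
(`AR.Cor29.IsLocalAddDatumAt / IotaComputesLimits / IotaIsEmbedding / IotaAdditive`, p414208) are proved here
for the data determined by a **chart package** at a point `x` of an ARBITRARY topological space `X`
(`W ∋ x` open, `e : X → ℂ` continuous on `W` into the ball `B(e x, r)`, `e' : ℂ → X` continuous on the ball
into `W`, mutually inverse there) and values in a complete field `𝕜` identified with `ℂ` by a ring isomorphism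
`κ : ℂ ≃+* 𝕜` (continuous; print: `k_v ≅ ℂ`): `a +ₓ b := e'(e a + e b − e x)`,
`(1/n)·ₓ v := e'(e x + (e v − e x)/n)` on `U_X = {v ∈ W | ‖e v − e x‖ < r/2}` (junk `x` off `U_X`, the
convention of `NFCurveData.Cor29Refined`), `ι(v) := κ(e v − e x) • id`, and for a `𝕜`-valued function `F`
vanishing at `x` with a chart expression `G` (`κ⁻¹ ∘ F = G ∘ e` near `x`, `G` complex-differentiable at `e x`)
the differential `dF|_x := κ(G′(e x))`:

* `isLocalAddDatumAt_pkg` (a.r1), `scale_of_not_mem` (junk clause);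
* `tendsto_nat_mul_pkg`, `iotaComputesLimits_pkg` (a.r2–a.r4: `n · F((1/n)·ₓ v) ⟶ ι(v)(dF|_x)`);
* `iotaIsEmbedding_pkg` (a.r5), `iotaAdditive_pkg` (a.r6), `iota_self_pkg` (`ι(x) = 0`).

This is the point-level engine of `ArchimedeanReconstructionCor29Globalise.lean` (Cor 2.9 for the genuine
datum `D : NFCurveData` under the chart-package hypothesis).  Refereed pre-IUT material; nothing here bears
on the disputed [IUTchIII] Cor. 3.12; typed ≠ endorsed.
-/

noncomputable section

namespace Literature.AnabelianGeometry.AbsoluteAnabelian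

open _root_.Set _root_.Topology _root_.Filter _root_.Metric _root_.Function
open ArchimedeanReconstruction ArchimedeanReconstruction.Cor29

namespace ArchimedeanReconstruction.Cor29ChartPackage

variable {X : Type} [TopologicalSpace X]
variable {W : Set X} {e : X → ℂ} {e' : ℂ → X} {x : X} {r : ℝ}

/-! ### Bookkeeping in the ball `B(e x, r)` -/

/-- Points of the half-neighbourhood have chart values in the ball. (Auxiliary.)
[cite: MochizukiAbsTopIII2015, Corollary 2.9 (a) p.65] -/
theorem mem_ball_of_norm_lt_half (hr : 0 < r) {w c : ℂ} (hw : ‖w - c‖ < r / 2) : w ∈ ball c r := by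
  rw [mem_ball, dist_eq_norm]; linarith

/-- `c + (w − c)/n ∈ B(c, r)` when `‖w − c‖ < r/2… < r` and `n ≥ 1`. (Auxiliary.)
[cite: MochizukiAbsTopIII2015, Corollary 2.9 (a) p.65] -/
theorem add_div_nat_mem_ball {w c : ℂ} (hw : ‖w - c‖ < r) {n : ℕ} (hn : 0 < n) :
    c + (w - c) / (n : ℂ) ∈ ball c r := by
  rw [mem_ball, dist_eq_norm, add_sub_cancel_left, norm_div, Complex.norm_natCast]
  exact (div_le_self (norm_nonneg _) (by exact_mod_cast hn)).trans_lt hw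

/-- `c + k • ((w − c)/n) ∈ B(c, r)` for `k ≤ n`, `n ≥ 1`, `‖w − c‖ < r`. (Auxiliary.)
[cite: MochizukiAbsTopIII2015, Corollary 2.9 (a) p.65] -/
theorem add_nat_mul_div_nat_mem_ball {w c : ℂ} (hw : ‖w - c‖ < r) {k n : ℕ} (hn : 0 < n) (hk : k ≤ n) :
    c + (k : ℂ) * ((w - c) / (n : ℂ)) ∈ ball c r := by
  rw [mem_ball, dist_eq_norm, add_sub_cancel_left]
  have hn' : (0 : ℝ) < n := by exact_mod_cast hn
  have hkn : (k : ℝ) / n ≤ 1 := by rw [div_le_one hn']; exact_mod_cast hk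
  calc ‖(k : ℂ) * ((w - c) / (n : ℂ))‖ = (k : ℝ) / n * ‖w - c‖ := by
        rw [norm_mul, norm_div, Complex.norm_natCast, Complex.norm_natCast]; ring
    _ ≤ 1 * ‖w - c‖ := by gcongr
    _ < r := by rw [one_mul]; exact hw

/-! ### Row a.r1: the transported local additive structure on an abstract charted neighbourhood -/

open Classical in
/-- **Row Cor-29.a.r1 for a chart package** `(W, e, e')` of `X` at `x` (`e : W ⥲ B(e x, r) ⊆ ℂ` with inverse
`e'`): the transported local additive structure `a +ₓ b := e⁻¹(e a + e b − e x)` with the division maps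
`(1/n)·ₓ v := e⁻¹(e x + (e v − e x)/n)` on `U_X = {v ∈ W | ‖e v − e x‖ < r/2}` (junk `x` off `U_X`) is a local
additive datum at `x`. [cite: MochizukiAbsTopIII2015, Corollary 2.9 (a) pp.64–65] -/
theorem isLocalAddDatumAt_pkg (hr : 0 < r) (hWo : IsOpen W) (hxW : x ∈ W) (he : ContinuousOn e W)
    (he' : ContinuousOn e' (ball (e x) r)) (he'm : MapsTo e' (ball (e x) r) W)
    (hl : ∀ v ∈ W, e' (e v) = v) (hrt : ∀ w ∈ ball (e x) r, e (e' w) = w) :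
    IsLocalAddDatumAt (fun a b => e' (e a + e b - e x))
      (fun n v => if v ∈ W ∧ ‖e v - e x‖ < r / 2 then e' (e x + (e v - e x) / (n : ℂ)) else x) x
      {v | v ∈ W ∧ ‖e v - e x‖ < r / 2} := by
  have hUopen : IsOpen {v | v ∈ W ∧ ‖e v - e x‖ < r / 2} := by
    have h := (he.sub (continuousOn_const (c := e x))).isOpen_inter_preimage hWo
      (isOpen_ball (x := (0 : ℂ)) (ε := r / 2))
    convert h using 1
    ext v; simp
  have hxU : x ∈ {v | v ∈ W ∧ ‖e v - e x‖ < r / 2} := ⟨hxW, by rw [sub_self, norm_zero]; positivity⟩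
  refine ⟨hUopen, hxU, fun b hb => ?_, fun a ha => ?_, ?_, fun n hn => ?_, fun n hn => ?_, fun n hn v hv => ?_⟩
  · show e' (e x + e b - e x) = b
    rw [add_sub_cancel_left, hl b hb.1]
  · show e' (e a + e x - e x) = a
    rw [add_sub_cancel_right, hl a ha.1]
  · have h1 : ContinuousOn (fun q : X × X => e q.1 + e q.2 - e x)
        ({v | v ∈ W ∧ ‖e v - e x‖ < r / 2} ×ˢ {v | v ∈ W ∧ ‖e v - e x‖ < r / 2}) :=
      ((he.comp continuous_fst.continuousOn fun q hq => (mem_prod.1 hq).1.1).add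
        (he.comp continuous_snd.continuousOn fun q hq => (mem_prod.1 hq).2.1)).sub continuousOn_const
    refine he'.comp h1 fun q hq => ?_
    obtain ⟨⟨-, h1'⟩, ⟨-, h2'⟩⟩ := mem_prod.1 hq
    rw [mem_ball, dist_eq_norm]
    calc ‖e q.1 + e q.2 - e x - e x‖ = ‖(e q.1 - e x) + (e q.2 - e x)‖ := by ring_nf
      _ ≤ ‖e q.1 - e x‖ + ‖e q.2 - e x‖ := norm_add_le _ _
      _ < r / 2 + r / 2 := add_lt_add h1' h2'
      _ = r := by ring
  · intro v hv
    have hvr : ‖e v - e x‖ < r := by linarith [hv.2]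
    have hw : e x + (e v - e x) / (n : ℂ) ∈ ball (e x) r := add_div_nat_mem_ball hvr hn
    have hv' : v ∈ W ∧ ‖e v - e x‖ < r / 2 := hv
    change (if v ∈ W ∧ ‖e v - e x‖ < r / 2 then e' (e x + (e v - e x) / (n : ℂ)) else x) ∈
      {v | v ∈ W ∧ ‖e v - e x‖ < r / 2}
    rw [if_pos hv']
    refine ⟨he'm hw, ?_⟩
    show ‖e (e' (e x + (e v - e x) / (n : ℂ))) - e x‖ < r / 2
    rw [hrt _ hw, add_sub_cancel_left, norm_div, Complex.norm_natCast]
    exact (div_le_self (norm_nonneg _) (by exact_mod_cast hn)).trans_lt hv.2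
  · have hcont : ContinuousOn (fun v => e' (e x + (e v - e x) / (n : ℂ))) {v | v ∈ W ∧ ‖e v - e x‖ < r / 2} := by
      refine he'.comp ((continuousOn_const.add (((he.mono fun v hv => hv.1).sub continuousOn_const).div_const _)))
        fun v hv => ?_
      exact add_div_nat_mem_ball (by linarith [hv.2]) hn
    refine hcont.congr fun v hv => ?_
    have hv' : v ∈ W ∧ ‖e v - e x‖ < r / 2 := hv
    exact if_pos hv'
  · have hvr : ‖e v - e x‖ < r := by linarith [hv.2]
    have hw : e x + (e v - e x) / (n : ℂ) ∈ ball (e x) r := add_div_nat_mem_ball hvr hn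
    have hv' : v ∈ W ∧ ‖e v - e x‖ < r / 2 := hv
    simp only [if_pos hv']
    have hiter : ∀ k : ℕ, k ≤ n →
        (fun b => e' (e (e' (e x + (e v - e x) / (n : ℂ))) + e b - e x))^[k] x =
          e' (e x + (k : ℂ) * ((e v - e x) / (n : ℂ))) := by
      intro k hk
      induction k with
      | zero => simp [hl x hxW]
      | succ k ih =>
        rw [Function.iterate_succ_apply', ih (Nat.le_of_succ_le hk), hrt _ hw,
          hrt _ (add_nat_mul_div_nat_mem_ball hvr hn (Nat.le_of_succ_le hk))]
        congr 1; push_cast; ring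
    rw [hiter n le_rfl]
    have hn' : (n : ℂ) ≠ 0 := by exact_mod_cast hn.ne'
    rw [mul_div_cancel₀ _ hn', add_sub_cancel, hl v hv.1]

omit [TopologicalSpace X] in
open Classical in
/-- The junk convention: off `U_X` the division maps return `x`. [cite: MochizukiAbsTopIII2015, Corollary 2.9 (a) p.65] -/
theorem scale_of_not_mem {v : X} (hv : v ∉ {v | v ∈ W ∧ ‖e v - e x‖ < r / 2}) (n : ℕ) :
    (fun n v => if v ∈ W ∧ ‖e v - e x‖ < r / 2 then e' (e x + (e v - e x) / (n : ℂ)) else x) n v = x := by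
  simp only [mem_setOf_eq] at hv
  simp only [hv, if_false]

/-! ### Rows a.r2–a.r4: the limits, computed by `ι` through the chart expression -/

section Values

variable {𝕜 : Type*} [NontriviallyNormedField 𝕜]

/-- **Rows a.r2–a.r4 for a chart package**: if the `𝕜`-valued function `F` on `X` vanishes at `x` and
reads, near `x` and through the identification `κ : ℂ ≃ 𝕜`, as a function `G` of the chart `e` that is
complex-differentiable at `e x`, then for `v ∈ U_X`,
`n · F((1/n)·ₓ v) ⟶ κ(e v − e x) · κ(G′(e x)) = ι(v)(dF|_x)`.
[cite: MochizukiAbsTopIII2015, Corollary 2.9 (a) p.65] -/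
theorem tendsto_nat_mul_pkg (κ : ℂ ≃+* 𝕜) (hκ : Continuous κ) (hr : 0 < r) (hxW : x ∈ W)
    (he' : ContinuousOn e' (ball (e x) r)) (hl : ∀ v ∈ W, e' (e v) = v)
    (hrt : ∀ w ∈ ball (e x) r, e (e' w) = w) {F : X → 𝕜} {G : ℂ → ℂ}
    (hG : DifferentiableAt ℂ G (e x)) (hFG : ∀ᶠ u in 𝓝 x, κ.symm (F u) = G (e u)) (hF0 : F x = 0)
    {v : X} (hv : v ∈ {v | v ∈ W ∧ ‖e v - e x‖ < r / 2}) :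
    Tendsto (fun n : ℕ => (n : 𝕜) * F (e' (e x + (e v - e x) / (n : ℂ)))) atTop
      (𝓝 (κ (e v - e x) * κ (deriv G (e x)))) := by
  have hG0 : G (e x) = 0 := by
    have h := hFG.self_of_nhds
    rw [hF0, map_zero] at h
    exact h.symm
  -- the limit in `ℂ`
  have hlimC : Tendsto (fun n : ℕ => (n : ℂ) * G (e x + (e v - e x) / (n : ℂ))) atTop
      (𝓝 (deriv G (e x) * (e v - e x))) := by
    have h := Cor29Model.tendsto_nat_mul_apply_scale (e x) hG.hasDerivAt hG0 (e v)
    simpa only [Cor29Model.scale_apply] using h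
  -- the points `(1/n)·ₓ v` tend to `x`, so eventually `F` reads through `G` there
  have hvr : ‖e v - e x‖ < r := by linarith [hv.2]
  have hwlim : Tendsto (fun n : ℕ => e x + (e v - e x) / (n : ℂ)) atTop (𝓝 (e x)) := by
    have h := (tendsto_const_div_atTop_nhds_zero_nat (e v - e x)).const_add (e x)
    rwa [add_zero] at h
  have hwmem : ∀ᶠ n : ℕ in atTop, e x + (e v - e x) / (n : ℂ) ∈ ball (e x) r := by
    filter_upwards [eventually_gt_atTop 0] with n hn
    exact add_div_nat_mem_ball hvr hn
  have hscale : Tendsto (fun n : ℕ => e' (e x + (e v - e x) / (n : ℂ))) atTop (𝓝 x) := by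
    have h1 : Tendsto (fun n : ℕ => e x + (e v - e x) / (n : ℂ)) atTop (𝓝[ball (e x) r] (e x)) :=
      tendsto_nhdsWithin_iff.2 ⟨hwlim, hwmem⟩
    have h2 := (he' (e x) (mem_ball_self hr)).tendsto.comp h1
    rwa [Function.comp_def, hl x hxW] at h2
  have hev : ∀ᶠ n : ℕ in atTop,
      (n : 𝕜) * F (e' (e x + (e v - e x) / (n : ℂ))) = κ ((n : ℂ) * G (e x + (e v - e x) / (n : ℂ))) := by
    filter_upwards [hscale.eventually hFG, hwmem] with n hn hmem
    rw [hrt _ hmem] at hn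
    rw [map_mul, map_natCast, ← hn, RingEquiv.apply_symm_apply]
  have hlim := (hκ.tendsto _).comp hlimC
  rw [show κ (e v - e x) * κ (deriv G (e x)) = κ (deriv G (e x) * (e v - e x)) by
    rw [← map_mul, mul_comm]]
  exact (hlim.congr' (EventuallyEq.symm hev) : _)

open Classical in
/-- **Rows a.r2–a.r4 for a chart package, family form** (`IotaComputesLimits`): for a family of values
`fval f : X → 𝕜` with chart expressions `G f` at the functions `f` vanishing at `x`, the functional
`ι(v) = κ(e v − e x) • id` computes the limits through `d f := κ((G f)′(e x))`.
[cite: MochizukiAbsTopIII2015, Corollary 2.9 (a) p.65] -/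
theorem iotaComputesLimits_pkg {Fn : Type*} (κ : ℂ ≃+* 𝕜) (hκ : Continuous κ) (hr : 0 < r) (hxW : x ∈ W)
    (he' : ContinuousOn e' (ball (e x) r)) (hl : ∀ v ∈ W, e' (e v) = v)
    (hrt : ∀ w ∈ ball (e x) r, e (e' w) = w) {fval : Fn → X → 𝕜} {van : Fn → Prop} {G : Fn → ℂ → ℂ}
    (hG : ∀ f, van f → DifferentiableAt ℂ (G f) (e x) ∧ (∀ᶠ u in 𝓝 x, κ.symm (fval f u) = G f (e u)) ∧
      fval f x = 0) :
    IotaComputesLimits fval van (fun f => κ (deriv (G f) (e x)))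
      (fun n v => if v ∈ W ∧ ‖e v - e x‖ < r / 2 then e' (e x + (e v - e x) / (n : ℂ)) else x)
      {v | v ∈ W ∧ ‖e v - e x‖ < r / 2} (fun v => (κ (e v - e x)) • (LinearMap.id : 𝕜 →ₗ[𝕜] 𝕜)) := by
  classical
  intro v hv f hf
  obtain ⟨hGd, hFG, hF0⟩ := hG f hf
  have hv' : v ∈ W ∧ ‖e v - e x‖ < r / 2 := hv
  simp only [if_pos hv', LinearMap.smul_apply, LinearMap.id_apply, smul_eq_mul]
  exact tendsto_nat_mul_pkg κ hκ hr hxW he' hl hrt hGd hFG hF0 hv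

/-! ### Rows a.r5/a.r6: embedding and additivity; the origin -/

/-- **Row a.r5 for a chart package** (`IotaIsEmbedding`): `v ↦ ι(v) = κ(e v − e x) • id` is a topological
embedding of `U_X` (indeed of any subset of `W`) — `e` is a chart and `κ` a homeomorphism.
[cite: MochizukiAbsTopIII2015, Corollary 2.9 (a) p.65] -/
theorem iotaIsEmbedding_pkg (κ : ℂ ≃+* 𝕜) (hκ : Continuous κ) (hκ' : Continuous κ.symm)
    (he : ContinuousOn e W) (he' : ContinuousOn e' (ball (e x) r)) (hem : MapsTo e W (ball (e x) r))
    (hl : ∀ v ∈ W, e' (e v) = v) {U : Set X} (hU : U ⊆ W) :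
    IotaIsEmbedding U (fun v => (κ (e v - e x)) • (LinearMap.id : 𝕜 →ₗ[𝕜] 𝕜)) := by
  unfold IotaIsEmbedding
  -- `h : U → 𝕜`, `h v = κ (e v − e x)`, is a homeomorphism onto its image
  have hcontg : Continuous (fun v : U => κ (e (v : X) - e x)) :=
    hκ.comp (((he.mono hU).comp_continuous continuous_subtype_val fun v => v.2).sub continuous_const)
  have hginj : Function.Injective (fun v : U => κ (e (v : X) - e x)) := by
    intro v w hvw
    apply Subtype.ext
    have h1 : e (v : X) = e (w : X) := by
      have := κ.injective hvw
      exact sub_left_injective this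
    rw [← hl _ (hU v.2), ← hl _ (hU w.2), h1]
  let H : U ≃ Set.range (fun v : U => κ (e (v : X) - e x)) := Equiv.ofInjective _ hginj
  have hHcont : Continuous H := by
    have h : Continuous (fun v : U => (⟨κ (e (v : X) - e x), Set.mem_range_self v⟩ :
        Set.range (fun v : U => κ (e (v : X) - e x)))) := hcontg.subtype_mk _
    refine h.congr fun v => ?_
    exact Subtype.ext (by simp [H, Equiv.ofInjective_apply])
  have hHsymm : Continuous H.symm := by
    have hformula : ∀ w : Set.range (fun v : U => κ (e (v : X) - e x)),
        ((H.symm w : U) : X) = e' (κ.symm (w : 𝕜) + e x) := by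
      intro w
      obtain ⟨v, hv⟩ := w.2
      have hw : H.symm w = v := by
        apply H.injective
        rw [Equiv.apply_symm_apply]
        exact Subtype.ext hv.symm
      rw [hw, ← hv]
      show (v : X) = e' (κ.symm (κ (e (v : X) - e x)) + e x)
      rw [RingEquiv.symm_apply_apply, sub_add_cancel, hl _ (hU v.2)]
    have h1 : Continuous (fun w : Set.range (fun v : U => κ (e (v : X) - e x)) =>
        e' (κ.symm (w : 𝕜) + e x)) := by
      refine he'.comp_continuous ((hκ'.comp continuous_subtype_val).add continuous_const) fun w => ?_
      obtain ⟨v, hv⟩ := w.2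
      rw [← hv]
      show κ.symm (κ (e (v : X) - e x)) + e x ∈ ball (e x) r
      rw [RingEquiv.symm_apply_apply, sub_add_cancel]
      exact hem (hU v.2)
    have h2 : Continuous (fun w : Set.range (fun v : U => κ (e (v : X) - e x)) => ((H.symm w : U) : X)) := by
      simp only [hformula]; exact h1
    exact continuous_induced_rng.2 h2
  let Hh : U ≃ₜ Set.range (fun v : U => κ (e (v : X) - e x)) :=
    { H with continuous_toFun := hHcont, continuous_invFun := hHsymm }
  have hemb : IsEmbedding (fun v : U => κ (e (v : X) - e x)) := by
    have : (fun v : U => κ (e (v : X) - e x)) = Subtype.val ∘ Hh := by funext v; rfl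
    rw [this]
    exact IsEmbedding.subtypeVal.comp Hh.isEmbedding
  have hcont : Continuous (fun v : U => fun ω : 𝕜 =>
      ((κ (e (v : X) - e x)) • (LinearMap.id : 𝕜 →ₗ[𝕜] 𝕜)) ω) := by
    refine continuous_pi fun ω => ?_
    simp only [LinearMap.smul_apply, LinearMap.id_apply, smul_eq_mul]
    exact hcontg.mul continuous_const
  have hev : Continuous (fun g : 𝕜 → 𝕜 => g 1) := continuous_apply 1
  have hcomp : (fun g : 𝕜 → 𝕜 => g 1) ∘
      (fun v : U => fun ω : 𝕜 => ((κ (e (v : X) - e x)) • (LinearMap.id : 𝕜 →ₗ[𝕜] 𝕜)) ω) =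
      fun v : U => κ (e (v : X) - e x) := by
    funext v; simp
  exact IsEmbedding.of_comp hcont hev (hcomp ▸ hemb)

omit [TopologicalSpace X] in
open Classical in
/-- **Row a.r6 for a chart package** (`IotaAdditive`): `ι(a +ₓ b) = ι a + ι b` on `U_X` and
`n • ι((1/n)·ₓ v) = ι v`. [cite: MochizukiAbsTopIII2015, Corollary 2.9 (a) p.65] -/
theorem iotaAdditive_pkg (κ : ℂ ≃+* 𝕜) (hr : 0 < r) (hrt : ∀ w ∈ ball (e x) r, e (e' w) = w) :
    IotaAdditive (𝕜 := 𝕜) (fun a b => e' (e a + e b - e x))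
      (fun n v => if v ∈ W ∧ ‖e v - e x‖ < r / 2 then e' (e x + (e v - e x) / (n : ℂ)) else x)
      {v | v ∈ W ∧ ‖e v - e x‖ < r / 2} (fun v => (κ (e v - e x)) • (LinearMap.id : 𝕜 →ₗ[𝕜] 𝕜)) := by
  refine ⟨fun a ha b hb _ => ?_, fun n hn v hv => ?_⟩
  · have hab : e a + e b - e x ∈ ball (e x) r := by
      rw [mem_ball, dist_eq_norm]
      calc ‖e a + e b - e x - e x‖ = ‖(e a - e x) + (e b - e x)‖ := by ring_nf
        _ ≤ ‖e a - e x‖ + ‖e b - e x‖ := norm_add_le _ _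
        _ < r / 2 + r / 2 := add_lt_add ha.2 hb.2
        _ = r := by ring
    refine LinearMap.ext fun ω => ?_
    simp only [LinearMap.smul_apply, LinearMap.id_apply, LinearMap.add_apply, smul_eq_mul, hrt _ hab]
    rw [← add_mul, ← map_add]
    congr 2; ring
  · have hv' : v ∈ W ∧ ‖e v - e x‖ < r / 2 := hv
    have hn' : (n : ℂ) ≠ 0 := by exact_mod_cast hn.ne'
    have hw : e x + (e v - e x) / (n : ℂ) ∈ ball (e x) r :=
      add_div_nat_mem_ball (by linarith [hv'.2]) hn
    refine LinearMap.ext fun ω => ?_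
    simp only [if_pos hv', LinearMap.smul_apply, LinearMap.id_apply, smul_eq_mul, hrt _ hw,
      add_sub_cancel_left]
    rw [← mul_assoc, ← map_natCast κ n, ← map_mul]
    congr 2
    field_simp

omit [TopologicalSpace X] in
/-- `ι(x) = 0`. [cite: MochizukiAbsTopIII2015, Corollary 2.9 (a) p.65] -/
theorem iota_self_pkg (κ : ℂ ≃+* 𝕜) :
    (fun v => (κ (e v - e x)) • (LinearMap.id : 𝕜 →ₗ[𝕜] 𝕜)) x = 0 := by
  simp


end Values

end ArchimedeanReconstruction.Cor29ChartPackage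

end Literature.AnabelianGeometry.AbsoluteAnabelian

end
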